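import Literature.Barriers.RiemannHypothesis.DavenportHeilbronnDegreeTwoProofs
import Literature.Barriers.RiemannHypothesis.DavenportHeilbronnDegreeTwoLevelOne
import Literature.Barriers.RiemannHypothesis.DavenportHeilbronnDegreeTwoTwist
import Literature.NumberTheory.EllipticCurves.NewformsRealCoefficients
import Literature.NumberTheory.EllipticCurves.ModularityVersionAp
import Literature.NumberTheory.EllipticCurves.NewformsLinearIndependenceProofs
import Literature.NumberTheory.EllipticCurves.CuspFormLFunctionEulerProductProofs
import HarnessLib

/-!
# Conrey–Ghosh 1994, Theorem 2 — the modular input: `Δ² = C(A − B)` and the reduction to a finite certificate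

Proofs only (no definitions, no named facts); sibling of `DavenportHeilbronnDegreeTwo.lean`.
Conrey–Ghosh, §8, p. 415: "the space of cusp forms of weight 24 for the full modular group has
dimension 2 … As a basis for this space we can take cusp forms `∑ a(n)e(nz)` and `∑ b(n)e(nz)`
where `a(n)` and `b(n)` are multiplicative … Since `a(1) = b(1) = 1` and `f(1) = 0`, it follows
that `F(s) = C(A(s) − B(s))` for some constant `C`." Here, with the tree's Atkin–Lehner theory for
`Γ₀(N)` (`newforms0`, multiplicity one, real coefficients, Hecke relations) at `N = 1`
(`DavenportHeilbronnDegreeTwoLevelOne.lean`) and Mathlib's dimension formula for level one: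

* `rank_cuspForm_levelOne_24` — `dim S_24(SL(2, ℤ)) = 2`; `card_le_two_of_subset_newforms0`;
* `exists_newforms_deltaSqCoeff` — two distinct newforms `A ≠ B` of `S_24(Γ₀(1))` and `C` with
  `f(n) = C(a(n) − b(n))` (`f = deltaSqCoeff`, `a = cuspCoeff A`, `b = cuspCoeff B`), `C(a(2) − b(2)) = 1`;
* `exists_newforms_deltaSqCoeff_arith` — `a`, `b` real, and `a(2) + b(2) = f(4)`,
  `a(2)b(2) = f(4)² − 2²⁴ − f(8)`, `a(p) = f(2p) − b(2)f(p)`, `b(p) = f(2p) − a(2)f(p)` (`p` odd):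
  all eigenvalue data are read off from the integers `f(n)`;
* `ConreyGhosh1994_thm2_of_cert` — **the reduction of `ConreyGhosh1994_thm2` to a finite
  certificate**: the twisted-Euler-product engine of `DavenportHeilbronnDegreeTwoTwist.lean`
  (`exists_real_zero_of_cert`, `exists_LSeries_eq_zero_of_twist_zero`) applied to `A`, `B` with
  the sign twist `χ(2) = −1`, `χ(p) = sgn(a(p) − b(p))`, followed by
  `ConreyGhosh1994_thm2_of_exists_zero`. The certificate is discharged in
  `DavenportHeilbronnDegreeTwoCert.lean`.

## References

* [ConreyGhosh1994] J. B. Conrey, A. Ghosh, Trans. AMS 342 (1994), §8, p. 415.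
* [DiamondShurman2005] F. Diamond, J. Shurman, GTM 228, Thm. 5.8.2, 5.8.3, Prop. 5.8.5.
-/

noncomputable section

open Complex Filter Metric Set Topology LSeries
open UpperHalfPlane hiding I
open CongruenceSubgroup
open scoped MatrixGroups
open Literature.NumberTheory.EllipticCurves.ModularForms

namespace Literature.Barriers.RiemannHypothesis

/-! ## `dim S_24(SL(2, ℤ)) = 2` -/

/-- `dim_ℂ S_24(SL(2, ℤ)) = 2` (`dim M_24 = 24/12 + 1 = 3 = 1 + dim S_24`).
[cite: ConreyGhosh1994, §8, p. 415] -/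
theorem rank_cuspForm_levelOne_24 : Module.rank ℂ (CuspForm 𝒮ℒ 24) = 2 := by
  have h1 := ModularForm.rank_eq_one_add_rank_cuspForm (k := 24) (by norm_num) ⟨12, rfl⟩
  have h2 := ModularForm.dimension_level_one 24 ⟨12, rfl⟩
  have h3 : ¬ (24 ≡ 2 [MOD 12]) := by decide
  rw [if_neg h3] at h2
  norm_num at h2
  rw [h2] at h1
  have h4 : (3 : Cardinal) = 1 + 2 := by norm_num
  rw [h4] at h1
  exact (Cardinal.eq_of_add_eq_add_left h1 (by simp)).symm

/-- The same at level `Γ₀(1) = SL(2, ℤ)`. [folklore] -/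
theorem rank_cuspForm_gamma0_one_24 : Module.rank ℂ (CuspForm (Gamma0 1) 24) = 2 := by
  let e : CuspForm 𝒮ℒ 24 ≃ₗ[ℂ] CuspForm (Gamma0 1) 24 :=
    { toFun := fun f ↦ CuspForm.mcast rfl f coe_gamma0_one
      invFun := fun g ↦ CuspForm.mcast rfl g coe_gamma0_one.symm
      map_add' := fun f g ↦ by ext z; rfl
      map_smul' := fun c f ↦ by ext z; rfl
      left_inv := fun f ↦ by ext z; rfl
      right_inv := fun g ↦ by ext z; rfl }
  rw [← e.rank_eq, rank_cuspForm_levelOne_24]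

/-- Hence there are at most two newforms of level one and weight `24`: a finite set of newforms
has at most two elements (newforms are linearly independent, `linearIndependent_newforms0_holds`).
[cite: DiamondShurman2005, Thm. 5.8.3] -/
theorem card_le_two_of_subset_newforms0 {s : Finset (CuspForm (Gamma0 1) 24)}
    (hs : ↑s ⊆ newforms0 1 24) : s.card ≤ 2 := by
  have hli : LinearIndepOn ℂ id (newforms0 1 24) := linearIndependent_newforms0_holds 1 24
  have hli' : LinearIndepOn ℂ id (↑s : Set (CuspForm (Gamma0 1) 24)) := hli.mono hs
  have h := LinearIndependent.cardinal_le_rank hli'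
  rw [rank_cuspForm_gamma0_one_24] at h
  have hcard : Cardinal.mk (↑s : Set (CuspForm (Gamma0 1) 24)) = s.card := by
    rw [Cardinal.mk_fintype]
    simp
  rw [hcard] at h
  exact_mod_cast h

/-! ## Fourier coefficients of combinations -/

/-- `aₙ(c • f + d • g) = c aₙ(f) + d aₙ(g)` on `S_k(Γ₀(N))`. [folklore] -/
theorem cuspCoeff_smul_add_smul {N : ℕ} {k : ℤ} (c d : ℂ) (f g : CuspForm (Gamma0 N) k) (n : ℕ) :
    cuspCoeff (c • f + d • g) n = c * cuspCoeff f n + d * cuspCoeff g n := by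
  have hΓ : (1 : ℝ) ∈ (Gamma0 N : Subgroup (GL (Fin 2) ℝ)).strictPeriods := by
    have h := (Gamma0 N : Subgroup (GL (Fin 2) ℝ)).strictWidthInfty_mem_strictPeriods
    rwa [CongruenceSubgroup.strictWidthInfty_Gamma0] at h
  have han : ∀ φ : CuspForm (Gamma0 N) k, AnalyticAt ℂ (cuspFunction 1 ⇑φ) 0 := fun φ ↦
    ModularFormClass.analyticAt_cuspFunction_zero φ one_pos hΓ
  change (qExpansion 1 ⇑(c • f + d • g)).coeff n =
    c * (qExpansion 1 ⇑f).coeff n + d * (qExpansion 1 ⇑g).coeff n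
  have hanS : ∀ (a : ℂ) (φ : CuspForm (Gamma0 N) k), AnalyticAt ℂ (cuspFunction 1 (a • ⇑φ)) 0 := by
    intro a φ
    rw [cuspFunction_smul (han φ).continuousAt]
    exact (han φ).const_smul
  rw [CuspForm.coe_add, CuspForm.IsGLPos.coe_smul, CuspForm.IsGLPos.coe_smul,
    qExpansion_add (hanS c f) (hanS d g), map_add, qExpansion_smul (han f), qExpansion_smul (han g)]
  simp [smul_eq_mul]

/-! ## `Δ² = C (A − B)` -/

/-- **Conrey–Ghosh, §8: `F(s) = C(A(s) − B(s))`.** There are two distinct newforms `A ≠ B` in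
`S_24(Γ₀(1))` and a constant `C ≠ 0` with `f(n) = C (a(n) − b(n))` for every `n`, where `f(n)`
are the Fourier coefficients of `Δ²` (`deltaSqCoeff`) and `a = cuspCoeff A`, `b = cuspCoeff B`;
moreover `a(2) ≠ b(2)` and `C (a(2) − b(2)) = 1` (`f(1) = 0`, `f(2) = 1`). Proof: `Δ²` is a
level-one cusp form of weight `24` which is not `T₂`-eigen, hence a combination of the level-one
newforms with at least two non-zero coefficients (`exists_newform_combination_of_not_isLevelOneHeckeEigenAt`);
as `dim S_24 = 2` there are exactly two newforms, and `f(1) = 0 = c_A + c_B`.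
[cite: ConreyGhosh1994, §8, p. 415] -/
theorem exists_newforms_deltaSqCoeff :
    ∃ A B : CuspForm (Gamma0 1) 24, IsNewform0 A ∧ IsNewform0 B ∧ A ≠ B ∧
      ∃ C : ℂ, C ≠ 0 ∧ C * (cuspCoeff A 2 - cuspCoeff B 2) = 1 ∧
        ∀ n : ℕ, deltaSqCoeff n = C * (cuspCoeff A n - cuspCoeff B n) := by
  classical
  obtain ⟨g, hg⟩ := exists_cuspForm_coe_eq_discriminant_sq
  have hne : ¬ IsLevelOneHeckeEigenAt 24 (fun n ↦ (qExpansion 1 g).coeff n) 2 := by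
    rw [qExpansion_coeff_eq_deltaSqCoeff hg]
    exact not_isLevelOneHeckeEigenAt_deltaSq
  obtain ⟨s, c, hs, hsum, A, hA, B, hB, hAB, hcA, hcB⟩ :=
    exists_newform_combination_of_not_isLevelOneHeckeEigenAt g Nat.prime_two hne
  -- `s = {A, B}`
  have hcard : s.card ≤ 2 := card_le_two_of_subset_newforms0 hs.le
  have hsAB : s = {A, B} := by
    symm
    refine Finset.eq_of_subset_of_card_le ?_ ?_
    · intro x hx
      simp only [Finset.mem_insert, Finset.mem_singleton] at hx
      rcases hx with rfl | rfl
      · exact hA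
      · exact hB
    · rw [Finset.card_pair hAB]
      exact hcard
  have hnewA : IsNewform0 A := hs.le hA
  have hnewB : IsNewform0 B := hs.le hB
  rw [hsAB, Finset.sum_pair hAB] at hsum
  -- coefficients
  have hcoeff : ∀ n, deltaSqCoeff n = c A * cuspCoeff A n + c B * cuspCoeff B n := by
    intro n
    rw [← cuspCoeff_smul_add_smul, cuspCoeff, hsum]
    exact (congrFun (qExpansion_coeff_eq_deltaSqCoeff hg) n).symm
  have h1 := hcoeff 1
  have h2 := hcoeff 2
  rw [deltaSqCoeff_one_two.1, show cuspCoeff A 1 = 1 from hnewA.2.2,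
    show cuspCoeff B 1 = 1 from hnewB.2.2, mul_one, mul_one] at h1
  have hcB' : c B = -c A := by linear_combination -h1
  rw [deltaSqCoeff_one_two.2, hcB'] at h2
  refine ⟨A, B, hnewA, hnewB, hAB, c A, hcA, by linear_combination -h2, fun n ↦ ?_⟩
  rw [hcoeff n, hcB']
  ring

/-- **Arithmetic form of `Δ² = C(A − B)`** (the data entering the twisted Euler products of
Conrey–Ghosh §8): two distinct newforms `A ≠ B` of `S_24(Γ₀(1))` with REAL, multiplicative
coefficients `a`, `b` satisfying `a(1) = b(1) = 1`, the prime recursion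
`a(p n) = a(p) a(n) − p²³ a(n/p)`, and `f(n) = C(a(n) − b(n))` with `C(a(2) − b(2)) = 1`; hence
`a(2) + b(2) = f(4)`, `a(2) b(2) = f(4)² − 2²⁴ − f(8)` and, for every odd prime `p`,
`a(p) = f(2p) − b(2) f(p)`, `b(p) = f(2p) − a(2) f(p)` — so all of `a(p)`, `b(p)` are read off from
the integer coefficients `f(n)` of `Δ²`. [cite: ConreyGhosh1994, §8, p. 415]
[cite: DiamondShurman2005, Prop. 5.8.5] -/
theorem exists_newforms_deltaSqCoeff_arith :
    ∃ A B : CuspForm (Gamma0 1) 24, IsNewform0 A ∧ IsNewform0 B ∧ A ≠ B ∧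
      ∃ C : ℂ, C ≠ 0 ∧ C * (cuspCoeff A 2 - cuspCoeff B 2) = 1 ∧
        (∀ n : ℕ, deltaSqCoeff n = C * (cuspCoeff A n - cuspCoeff B n)) ∧
        (∀ n : ℕ, (cuspCoeff A n).im = 0 ∧ (cuspCoeff B n).im = 0) ∧
        cuspCoeff A 2 + cuspCoeff B 2 = deltaSqCoeff 4 ∧
        cuspCoeff A 2 * cuspCoeff B 2 = deltaSqCoeff 4 ^ 2 - 2 ^ 24 - deltaSqCoeff 8 ∧
        (∀ p : ℕ, p.Prime → p ≠ 2 →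
          cuspCoeff A p = deltaSqCoeff (2 * p) - cuspCoeff B 2 * deltaSqCoeff p ∧
          cuspCoeff B p = deltaSqCoeff (2 * p) - cuspCoeff A 2 * deltaSqCoeff p) := by
  obtain ⟨A, B, hA, hB, hAB, C, hC, hC2, hf⟩ := exists_newforms_deltaSqCoeff
  have hA1 : cuspCoeff A 1 = 1 := hA.2.2
  have hB1 : cuspCoeff B 1 = 1 := hB.2.2
  -- the prime recursion at `p = 2` (level `1`: `2 ∤ 1`, weight `24`: `p^{k-1} = 2²³`)
  have key : ∀ {X : CuspForm (Gamma0 1) 24}, IsNewform0 X → ∀ n : ℕ,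
      cuspCoeff X (2 * n) = cuspCoeff X 2 * cuspCoeff X n -
        (2 : ℂ) ^ 23 * (if 2 ∣ n then cuspCoeff X (n / 2) else 0) := by
    intro X hX n
    have h := hX.cuspCoeff_prime_mul Nat.prime_two n
    rw [if_neg (by decide : ¬ (2 ∣ 1))] at h
    rw [h]
    norm_num
  have hA4 : cuspCoeff A 4 = cuspCoeff A 2 ^ 2 - 2 ^ 23 := by
    have h := key hA 2
    rw [if_pos (dvd_refl 2)] at h
    norm_num at h
    rw [hA1] at h
    linear_combination h
  have hB4 : cuspCoeff B 4 = cuspCoeff B 2 ^ 2 - 2 ^ 23 := by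
    have h := key hB 2
    rw [if_pos (dvd_refl 2)] at h
    norm_num at h
    rw [hB1] at h
    linear_combination h
  have hA8 : cuspCoeff A 8 = cuspCoeff A 2 * cuspCoeff A 4 - 2 ^ 23 * cuspCoeff A 2 := by
    have h := key hA 4
    rw [if_pos (by norm_num : 2 ∣ 4)] at h
    norm_num at h
    linear_combination h
  have hB8 : cuspCoeff B 8 = cuspCoeff B 2 * cuspCoeff B 4 - 2 ^ 23 * cuspCoeff B 2 := by
    have h := key hB 4
    rw [if_pos (by norm_num : 2 ∣ 4)] at h
    norm_num at h
    linear_combination h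
  -- `f(4) = a(2) + b(2)` and `f(8) = a(2)² + a(2)b(2) + b(2)² − 2²⁴`
  have hf4 : deltaSqCoeff 4 = cuspCoeff A 2 + cuspCoeff B 2 := by
    have h := hf 4
    have hdiff : cuspCoeff A 4 - cuspCoeff B 4 =
        (cuspCoeff A 2 - cuspCoeff B 2) * (cuspCoeff A 2 + cuspCoeff B 2) := by
      rw [hA4, hB4]; ring
    rwa [hdiff, ← mul_assoc, hC2, one_mul] at h
  have hf8 : deltaSqCoeff 8 = cuspCoeff A 2 ^ 2 + cuspCoeff A 2 * cuspCoeff B 2 +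
      cuspCoeff B 2 ^ 2 - 2 ^ 24 := by
    have h := hf 8
    have hdiff : cuspCoeff A 8 - cuspCoeff B 8 = (cuspCoeff A 2 - cuspCoeff B 2) *
        (cuspCoeff A 2 ^ 2 + cuspCoeff A 2 * cuspCoeff B 2 + cuspCoeff B 2 ^ 2 - 2 ^ 24) := by
      rw [hA8, hB8, hA4, hB4]; ring
    rwa [hdiff, ← mul_assoc, hC2, one_mul] at h
  refine ⟨A, B, hA, hB, hAB, C, hC, hC2, hf, fun n ↦ ⟨hA.cuspCoeff_im_eq_zero n,
    hB.cuspCoeff_im_eq_zero n⟩, hf4.symm, ?_, ?_⟩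
  · rw [hf4, hf8]; ring
  · intro p hp hp2
    have hodd : ¬ 2 ∣ p := by
      intro h2
      exact hp2 ((Nat.prime_dvd_prime_iff_eq Nat.prime_two hp).1 h2).symm
    have hAp : cuspCoeff A (2 * p) = cuspCoeff A 2 * cuspCoeff A p := by
      have h := key hA p
      rw [if_neg hodd, mul_zero, sub_zero] at h
      exact h
    have hBp : cuspCoeff B (2 * p) = cuspCoeff B 2 * cuspCoeff B p := by
      have h := key hB p
      rw [if_neg hodd, mul_zero, sub_zero] at h
      exact h
    rw [hf (2 * p), hf p, hAp, hBp]
    constructor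
    · linear_combination (-(cuspCoeff A p)) * hC2
    · linear_combination (-(cuspCoeff B p)) * hC2


/-! ## Assembly for `Δ²`: from the certificate to `ConreyGhosh1994_thm2` -/

/-- Real and imaginary parts of the unimodular sign twist `X = complMul e`, `e(p) ∈ {±1} ⊂ ℝ`:
`X(n)` is real for every `n`. [folklore] -/
theorem complMul_im_eq_zero {e : ℕ → ℂ} (he : ∀ p, p.Prime → (e p).im = 0) (n : ℕ) :
    (complMul e n).im = 0 := by
  induction n using Nat.recOnPosPrimePosCoprime with
  | prime_pow p k hp hk =>
    rw [complMul_prime_pow e hp, show e p = ((e p).re : ℂ) from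
      (Complex.ext (by simp) (by simp [he p hp])), ← Complex.ofReal_pow, Complex.ofReal_im]
  | zero => simp
  | one => simp
  | coprime a b ha hb hab iha ihb => rw [map_mul, Complex.mul_im, iha, ihb]; ring

/-- **Conrey–Ghosh's Theorem 2 from the finite certificate.** Write `f(n)` for the coefficients
of `Δ²` (`deltaSqCoeff`). Suppose that for every pair of real sequences `a`, `b` with
`a(1) = b(1) = 1`, `b(2) < a(2)`, `a(2) + b(2) = f(4)`, `a(2)b(2) = f(4)² − 2²⁴ − f(8)` and
`a(p) = f(2p) − b(2)f(p)`, `b(p) = f(2p) − a(2)f(p)` at the odd primes — the shape of the Hecke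
eigenvalues of the two newforms of `S_24(SL(2, ℤ))`, `exists_newforms_deltaSqCoeff_arith` — there
are `σ₁ > 25/2` and a finite set of primes `T ∋ 2` with
`∏_{p∈T} (1 − χ(p)a(p)p^{-σ₁} + p^{23−2σ₁}) < ∏_{p∈T} (1 − χ(p)b(p)p^{-σ₁} + p^{23−2σ₁})` for the
signs `χ(2) = −1`, `χ(p) = sgn(a(p) − b(p))` (`p` odd). Then `L(s, Δ²)` has infinitely many zeros
with `Re s > 25/2` at which it converges (`ConreyGhosh1994_thm2`): the certificate gives
`Z(σ₁) > 0` for the twisted difference `Z = A^χ − B^χ` (`exists_real_zero_of_cert`), which is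
negative far to the right, so `Z` has a real zero `σ₀ > σ₁`; Kronecker's theorem and Hurwitz's
theorem turn it into a zero of `A − B = L(·, Δ²)/C` right of `σ₁`
(`exists_LSeries_eq_zero_of_twist_zero`), and one zero gives infinitely many
(`ConreyGhosh1994_thm2_of_exists_zero`). [cite: ConreyGhosh1994, Thm. 2 and §8] -/
theorem ConreyGhosh1994_thm2_of_cert
    (hcert : ∀ a b : ℕ → ℝ, a 1 = 1 → b 1 = 1 → b 2 < a 2 →
      ((a 2 : ℂ) + b 2 = deltaSqCoeff 4) →
      ((a 2 : ℂ) * b 2 = deltaSqCoeff 4 ^ 2 - 2 ^ 24 - deltaSqCoeff 8) →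
      (∀ p : ℕ, p.Prime → p ≠ 2 →
        (a p : ℂ) = deltaSqCoeff (2 * p) - b 2 * deltaSqCoeff p ∧
        (b p : ℂ) = deltaSqCoeff (2 * p) - a 2 * deltaSqCoeff p) →
      ∃ σ₁ : ℝ, 25 / 2 < σ₁ ∧ ∃ T : Finset ℕ, 2 ∈ T ∧ (∀ n ∈ T, n.Prime) ∧
        ∏ n ∈ T, (1 - (if n = 2 then (-1 : ℝ) else if b n ≤ a n then 1 else -1) * a n *
            (n : ℝ) ^ (-σ₁) + (n : ℝ) ^ 23 * ((n : ℝ) ^ (-σ₁)) ^ 2) <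
        ∏ n ∈ T, (1 - (if n = 2 then (-1 : ℝ) else if b n ≤ a n then 1 else -1) * b n *
            (n : ℝ) ^ (-σ₁) + (n : ℝ) ^ 23 * ((n : ℝ) ^ (-σ₁)) ^ 2)) :
    ConreyGhosh1994_thm2 := by
  -- the two newforms, ordered so that `b(2) < a(2)`
  obtain ⟨A₀, B₀, hA₀, hB₀, -, C₀, -, hC₀2, hf₀, -, hs₀, hp₀, hodd₀⟩ :=
    exists_newforms_deltaSqCoeff_arith
  obtain ⟨A, B, hA, hB, C, hC2, hf, hs2, hp2, hodd, hlt⟩ : ∃ A B : CuspForm (Gamma0 1) 24,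
      IsNewform0 A ∧ IsNewform0 B ∧ ∃ C : ℂ, C * (cuspCoeff A 2 - cuspCoeff B 2) = 1 ∧
      (∀ n, deltaSqCoeff n = C * (cuspCoeff A n - cuspCoeff B n)) ∧
      cuspCoeff A 2 + cuspCoeff B 2 = deltaSqCoeff 4 ∧
      cuspCoeff A 2 * cuspCoeff B 2 = deltaSqCoeff 4 ^ 2 - 2 ^ 24 - deltaSqCoeff 8 ∧
      (∀ p : ℕ, p.Prime → p ≠ 2 →
        cuspCoeff A p = deltaSqCoeff (2 * p) - cuspCoeff B 2 * deltaSqCoeff p ∧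
        cuspCoeff B p = deltaSqCoeff (2 * p) - cuspCoeff A 2 * deltaSqCoeff p) ∧
      (cuspCoeff B 2).re < (cuspCoeff A 2).re := by
    have hne : (cuspCoeff A₀ 2).re ≠ (cuspCoeff B₀ 2).re := by
      intro h
      have h' : cuspCoeff A₀ 2 = cuspCoeff B₀ 2 := by
        rw [hA₀.cuspCoeff_eq_ofReal_re, hB₀.cuspCoeff_eq_ofReal_re, h]
      rw [h', sub_self, mul_zero] at hC₀2
      exact zero_ne_one hC₀2
    rcases lt_or_gt_of_ne hne with h | h
    · refine ⟨B₀, A₀, hB₀, hA₀, -C₀, by linear_combination hC₀2, fun n ↦ ?_, by rw [← hs₀]; ring,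
        by rw [← hp₀]; ring, fun p hp hp2 ↦ ⟨(hodd₀ p hp hp2).2, (hodd₀ p hp hp2).1⟩, h⟩
      rw [hf₀ n]; ring
    · exact ⟨A₀, B₀, hA₀, hB₀, C₀, hC₀2, hf₀, hs₀, hp₀, hodd₀, h⟩
  -- real coefficient systems
  obtain ⟨a, ha⟩ : ∃ f : ℕ → ℝ, f = fun n ↦ (cuspCoeff A n).re := ⟨_, rfl⟩
  obtain ⟨b, hb⟩ : ∃ f : ℕ → ℝ, f = fun n ↦ (cuspCoeff B n).re := ⟨_, rfl⟩
  have hAa : ∀ n, cuspCoeff A n = (a n : ℂ) := fun n ↦ by rw [ha]; exact hA.cuspCoeff_eq_ofReal_re n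
  have hBb : ∀ n, cuspCoeff B n = (b n : ℂ) := fun n ↦ by rw [hb]; exact hB.cuspCoeff_eq_ofReal_re n
  have ha1 : a 1 = 1 := by
    have h : cuspCoeff A 1 = 1 := hA.2.2
    rw [hAa] at h; exact_mod_cast h
  have hb1 : b 1 = 1 := by
    have h : cuspCoeff B 1 = 1 := hB.2.2
    rw [hBb] at h; exact_mod_cast h
  have hmul_of : ∀ {X : CuspForm (Gamma0 1) 24} {x : ℕ → ℝ}, IsNewform0 X →
      (∀ n, cuspCoeff X n = (x n : ℂ)) → ∀ {m n : ℕ}, m.Coprime n → x (m * n) = x m * x n := by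
    intro X x hX hx m n hmn
    have h := IsNewform0.coeff_mul_of_coprime_holds hX hmn
    change cuspCoeff X (m * n) = cuspCoeff X m * cuspCoeff X n at h
    rw [hx, hx, hx] at h; exact_mod_cast h
  have hrec_of : ∀ {X : CuspForm (Gamma0 1) 24} {x : ℕ → ℝ}, IsNewform0 X →
      (∀ n, cuspCoeff X n = (x n : ℂ)) → ∀ {p : ℕ}, p.Prime → ∀ r : ℕ,
        x (p ^ (r + 2)) = x p * x (p ^ (r + 1)) - (p : ℝ) ^ (23 : ℕ) * x (p ^ r) := by
    intro X x hX hx p hp r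
    have h := hX.cuspCoeff_prime_pow_add_two_weight hp r
    rw [if_neg (Nat.Prime.not_dvd_one hp), hx, hx, hx, hx,
      show ((24 : ℤ) - 1) = ((23 : ℕ) : ℤ) by norm_num, zpow_natCast] at h
    exact_mod_cast h
  have hsum_of : ∀ {X : CuspForm (Gamma0 1) 24} {x : ℕ → ℝ},
      (∀ n, cuspCoeff X n = (x n : ℂ)) → ∀ σ : ℝ, (25 / 2 : ℝ) < σ →
        LSeriesSummable (fun n ↦ (x n : ℂ)) σ := by
    intro X x hx σ hσ
    have h := LSeriesSummable_cuspCoeff_of_lt_re (CongruenceSubgroup.strictWidthInfty_Gamma0 1) X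
      (s := (σ : ℂ)) (by simp only [ofReal_re]; push_cast; linarith)
    exact (LSeriesSummable_congr _ fun {n} _ ↦ (hx n)).1 h
  -- the sign twist
  obtain ⟨ec, hec⟩ : ∃ f : ℕ → ℂ, f = fun p : ℕ ↦
      (((if p = 2 then (-1 : ℝ) else if b p ≤ a p then (1 : ℝ) else (-1 : ℝ)) : ℝ) : ℂ) := ⟨_, rfl⟩
  have hec_val : ∀ p, ec p = 1 ∨ ec p = -1 := by
    intro p; rw [hec]; simp only; split_ifs <;> simp
  have hec_norm : ∀ p, p.Prime → ‖ec p‖ = 1 := by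
    intro p _; rcases hec_val p with h | h <;> simp [h]
  have hec_im : ∀ p, p.Prime → (ec p).im = 0 := by
    intro p _; rcases hec_val p with h | h <;> simp [h]
  obtain ⟨ε, hε⟩ : ∃ f : ℕ → ℝ, f = fun n ↦ (complMul ec n).re := ⟨_, rfl⟩
  have hXε : ∀ n, complMul ec n = (ε n : ℂ) := fun n ↦
    Complex.ext (by simp [hε]) (by simp [complMul_im_eq_zero hec_im n])
  have hε1 : ε 1 = 1 := by simp [hε]
  have hεmul : ∀ m n, ε (m * n) = ε m * ε n := by
    intro m n
    have h := (complMul ec).map_mul m n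
    rw [hXε, hXε, hXε] at h; exact_mod_cast h
  have hεp : ∀ p, p.Prime → ε p = (if p = 2 then (-1 : ℝ) else if b p ≤ a p then (1 : ℝ) else (-1 : ℝ)) := by
    intro p hp
    have h := complMul_prime ec hp
    rw [hXε, hec] at h
    simp only at h
    exact_mod_cast h
  have hεsq : ∀ p, p.Prime → ε p ^ 2 = 1 := by
    intro p hp; rw [hεp p hp]; split_ifs <;> norm_num
  -- the certificate, instantiated
  have hs2' : (a 2 : ℂ) + b 2 = deltaSqCoeff 4 := by rw [← hAa, ← hBb]; exact hs2
  have hp2' : (a 2 : ℂ) * b 2 = deltaSqCoeff 4 ^ 2 - 2 ^ 24 - deltaSqCoeff 8 := by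
    rw [← hAa, ← hBb]; exact hp2
  have hodd' : ∀ p : ℕ, p.Prime → p ≠ 2 →
      (a p : ℂ) = deltaSqCoeff (2 * p) - b 2 * deltaSqCoeff p ∧
      (b p : ℂ) = deltaSqCoeff (2 * p) - a 2 * deltaSqCoeff p := by
    intro p hp hp2; rw [← hAa, ← hBb, ← hAa, ← hBb]; exact hodd p hp hp2
  have hlt' : b 2 < a 2 := by
    have := hlt; rwa [hAa, hBb, ofReal_re, ofReal_re] at this
  obtain ⟨σ₁, hσ₁, T, hT2, hTp, hineq⟩ := hcert a b ha1 hb1 hlt' hs2' hp2' hodd'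
  have hineq' : ∏ n ∈ T, (1 - ε n * a n * (n : ℝ) ^ (-σ₁) + (n : ℝ) ^ (23 : ℕ) * ((n : ℝ) ^ (-σ₁)) ^ 2) <
      ∏ n ∈ T, (1 - ε n * b n * (n : ℝ) ^ (-σ₁) + (n : ℝ) ^ (23 : ℕ) * ((n : ℝ) ^ (-σ₁)) ^ 2) := by
    have e1 : ∏ n ∈ T, (1 - ε n * a n * (n : ℝ) ^ (-σ₁) + (n : ℝ) ^ (23 : ℕ) * ((n : ℝ) ^ (-σ₁)) ^ 2) =
        ∏ n ∈ T, (1 - (if n = 2 then (-1 : ℝ) else if b n ≤ a n then 1 else -1) * a n *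
            (n : ℝ) ^ (-σ₁) + (n : ℝ) ^ 23 * ((n : ℝ) ^ (-σ₁)) ^ 2) :=
      Finset.prod_congr rfl fun n hn ↦ by rw [hεp n (hTp n hn)]
    have e2 : ∏ n ∈ T, (1 - ε n * b n * (n : ℝ) ^ (-σ₁) + (n : ℝ) ^ (23 : ℕ) * ((n : ℝ) ^ (-σ₁)) ^ 2) =
        ∏ n ∈ T, (1 - (if n = 2 then (-1 : ℝ) else if b n ≤ a n then 1 else -1) * b n *
            (n : ℝ) ^ (-σ₁) + (n : ℝ) ^ 23 * ((n : ℝ) ^ (-σ₁)) ^ 2) :=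
      Finset.prod_congr rfl fun n hn ↦ by rw [hεp n (hTp n hn)]
    rw [e1, e2]; exact hineq
  -- the real zero of the twisted difference
  obtain ⟨σ₀, hσ₀, hZ⟩ := exists_real_zero_of_cert (m := 23) (σc := 25 / 2) ha1 hb1
    (hmul_of hA hAa) (hmul_of hB hBb) (hrec_of hA hAa) (hrec_of hB hBb) hε1 hεmul hεsq
    (hsum_of hAa) (hsum_of hBb) (by norm_num)
    (by rw [hεp 2 Nat.prime_two, if_pos rfl]; linarith)
    (fun p hp hp2 ↦ by
      rw [hεp p hp, if_neg hp2]
      split_ifs with h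
      · linarith
      · push Not at h; nlinarith)
    hσ₁ hT2 hTp hineq'
  -- Kronecker + Hurwitz: a zero of `A − B` right of `σ₁`
  obtain ⟨u, hu⟩ : ∃ f : ℕ → ℂ, f = fun n ↦ cuspCoeff A n - cuspCoeff B n := ⟨_, rfl⟩
  have husum : ∀ σ : ℝ, (25 / 2 : ℝ) < σ → LSeriesSummable u σ := fun σ hσ ↦ by
    rw [hu]
    have h := (hsum_of hAa σ hσ).sub (hsum_of hBb σ hσ)
    exact (LSeriesSummable_congr _ fun {n} _ ↦ by simp [hAa, hBb]).1 h
  have habs : abscissaOfAbsConv u < σ₁ :=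
    lt_of_le_of_lt (abscissaOfAbsConv_le_of_forall_lt_LSeriesSummable fun y hy ↦ husum y hy)
      (by exact_mod_cast hσ₁)
  have hZ' : LSeries (fun n ↦ complMul ec n * u n) σ₀ = 0 := by
    rw [← hZ]
    congr 1
    funext n
    rw [hXε, hu]
    simp only [hAa, hBb]
    push_cast; ring
  obtain ⟨s, hs, hs0⟩ := exists_LSeries_eq_zero_of_twist_zero hec_norm hσ₀ habs hZ'
  -- `L(s, Δ²) = C (A − B)(s) = 0`
  refine ConreyGhosh1994_thm2_of_exists_zero ⟨s, by linarith, ?_⟩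
  have hfun : deltaSqCoeff = C • u := by
    funext n; rw [Pi.smul_apply, smul_eq_mul, hf n, hu]
  rw [hfun, LSeries_smul, hs0, mul_zero]

end Literature.Barriers.RiemannHypothesis

end
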